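import Summits.PneNP.PneNP.Theses.PhaseTwins
import Literature.Computability.Complexity.HardcoreInapproximability
import Literature.Computability.Complexity.HamCircuitNP
import Literature.Computability.Complexity.ParityClosure
import Literature.Computability.Complexity.SharpPClosure
import Literature.Computability.Complexity.GapNatPSpace
import Literature.Computability.Complexity.FPStringBricks
import Literature.Computability.Complexity.BranchingFn

/-!
# The hard-core count is a `#P` function — assembly of the route's support item `HardcoreCountSharpP`

Line `SketchIdeator1` for the crux `Summit.PneNP.PneNP.Theses.PhaseTwins.NoFBPPApproxAboveUniqueness`
(stmt-PneNP-2717, route PneNP/PhaseTwins), stub `stub_sharpPAssembly` (the lead's assembly step of the `#P`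
membership of the hard-core counting function, i.e. of the route's support item `HardcoreCountSharpP`,
stmt-PneNP-2722 — the first hypothesis of the route's Assembly and of the line's Theorem N), stated with its
three machine-level ingredients as HYPOTHESES so that this file depends on `Literature` and the route file only;
the ingredients are the line's stubs T1, T2a, T2b, all LANDED as theorems of this namespace:

* `h1` = `stub_graphCanon` (`Theorems/PhaseTwinsNoFBPPApproxAboveUniquenessGraphCanon.lean`): the re-encoding
  `cg = encode ∘ decode` of graph codes is in `FP` (undecodable words go to the non-code-word `⟨⌜1⌝, ε⟩`);
* `h2a` = `stub_indepVerifier` (`…IndepVerifier.lean`): a `P` verifier `V` for "`z` is the characteristic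
  vector of an independent set of the coded graph";
* `h2b` = `stub_maxDegreeTest` (`…MaxDegreeTest.lean`): a `P` test `D` of the promise "maximum degree `≤ Δ`".

Proof (Valiant's closure properties of `#P`, Arora–Barak §17.4.2): the weight `⟨x, z⟩ ↦ ∏_{j<|z|} (z_j ? p : q)
= p^{#1(z)} q^{#0(z)}` is a `#P` function (`prod_mem_SharpP` of the value of an `FP` numeral,
`natFP_mem_SharpP`); so is `φ = [· ∈ V] · weight` (`ite_mem_SharpP`), the sum
`S x = Σ_{z ∈ {0,1}^{n(x)}} φ ⟨x, z⟩` (`sum_mem_SharpP`, `n(x)` read off the code in unary by `binToUnaryFn`),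
`Φ = [· ∈ gcodeLang ∩ D] · S` and `Φ ∘ cg` (`comp_mem_SharpP`). Finally `hardcoreCount Δ p q = Φ ∘ cg`
pointwise: both vanish on undecodable words (`cg w = ⟨⌜1⌝, ε⟩` is not a code word) and off the degree
promise, and on the code of `⟨n, G⟩` with `Δ(G) ≤ Δ` the sum over bit vectors `z ∈ {0,1}^n` is the sum over
vertex subsets `I ⊆ Fin n` of `[I independent] p^{|I|} q^{n-|I|}` (characteristic vectors).

## References

* L. G. Valiant, *The complexity of computing the permanent*, TCS 8 (1979), §2 [Valiant1979].
* S. Arora, B. Barak, *Computational Complexity: A Modern Approach*, CUP 2009, Def. 17.2, §17.4.2 [AroraBarak2009].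
* R. M. Karp, *Reducibility among combinatorial problems*, 1972, §4 (graph codes, certificates) [Karp1972].
-/

set_option linter.dupNamespace false

namespace Summit.PneNP.PneNP.Theorems.NoFBPPApproxAboveUniqueness

open Literature.Computability.Complexity
open _root_.Computability Polynomial Brick Plumb OracleCompose HashBricks Finset
open Summit.PneNP.PneNP.Theses.PhaseTwins (HardcoreCountSharpP)

/-! ### The weight `p^{#1(z)} q^{#0(z)}` is a `#P` function -/

/-- **The weight is in `#P`**: `⟨x, z⟩ ↦ ∏_{j < |z|} (if z_j then p else q)` — a product over the positions of
`z = sndF v` of the value of the `FP` numeral `⌜p⌝`/`⌜q⌝` selected by the bit (`prod_mem_SharpP`,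
`natFP_mem_SharpP`). [cite: AroraBarak2009, §17.4.2 eq. (17.5)] -/
theorem weightProd_mem_SharpP (p q : ℕ) :
    (fun v : List Bool => ∏ j ∈ range (sndF v).length, (if (sndF v).getD j false then p else q)) ∈ SharpP := by
  -- the bit selector `⟨v, 1ʲ⟩ ↦ [z_j]`, `z = sndF v`
  set cond : List Bool → List Bool := headBitFn ∘ dropFn ∘ fanoutFn sndF (sndF ∘ fstF) with hcond
  set tsel : List Bool → List Bool := iteFn cond (fun _ => encodeNat p) (fun _ => encodeNat q) with htsel
  have hcondFP : cond ∈ FP :=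
    comp_mem_FP headBitFn_mem_FP (comp_mem_FP dropFn_mem_FP
      (fanoutFn_mem_FP sndF_mem_FP (comp_mem_FP sndF_mem_FP fstF_mem_FP)))
  have htselFP : tsel ∈ FP := iteFn_mem_FP hcondFP (const_mem_FP _) (const_mem_FP _)
  have hcond_apply : ∀ (v : List Bool) (j : ℕ), cond (boolPair v (ones j)) = [(sndF v).getD j false] := by
    intro v j
    simp only [hcond, Function.comp_apply, fanoutFn_apply, sndF_boolPair, fstF_boolPair, dropFn_boolPair,
      List.length_replicate, headBitFn_apply, CliqueNP.headD_drop]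
  have htsel_apply : ∀ (v : List Bool) (j : ℕ),
      bitsToNat (tsel (boolPair v (ones j))) = if (sndF v).getD j false then p else q := by
    intro v j
    rw [htsel, iteFn_apply (hcond_apply v j)]
    cases (sndF v).getD j false <;> simp [bitsToNat_encodeNat]
  have hψ : (fun w => bitsToNat (tsel w)) ∈ SharpP := natFP_mem_SharpP htselFP
  have hprod := ParityClosure.prod_mem_SharpP hψ sndF_mem_FP
  refine (congrArg (· ∈ SharpP) ?_).mp hprod
  funext v
  exact prod_congr rfl fun j _ => htsel_apply v j

/-! ### Small facts about graph codes -/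

/-- The fixed junk word `⟨⌜1⌝, ε⟩` is not a graph code word. [folklore] -/
theorem junk_not_mem_gcodeLang : boolPair (encodeNat 1) [] ∉ HamNP.gcodeLang := by
  intro h
  obtain ⟨n, G, hx⟩ := (HamNP.mem_gcodeLang_iff _).1 h
  rw [HamNP.encode_eq] at hx
  have h1 := congrArg fstF hx
  have h2 := congrArg sndF hx
  simp only [fstF_boolPair, sndF_boolPair] at h1 h2
  have hn : n = 1 := by
    have := congrArg decodeNat h1
    simpa [decode_encodeNat] using this.symm
  subst hn
  have := congrArg List.length h2
  simp at this

/-- The unary yardstick `x ↦ 1^{min ⟦fstF x⟧ |x|}` reads the dimension `n` off a code word (`n ≤ |code|`).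
[folklore] -/
theorem yard_encode (n : ℕ) (G : SimpleGraph (Fin n)) :
    (binToUnaryFn ∘ fanoutFn id fstF) (encodingGraph.encode ⟨n, G⟩) = ones n := by
  have hle : n ≤ (encodingGraph.encode ⟨n, G⟩).length := by
    rw [HamNP.encode_eq, length_boolPair, CliqueNP.length_adjBits]
    nlinarith [Nat.le_mul_self n]
  rw [Function.comp_apply, fanoutFn_apply, binToUnaryFn_boolPair]
  simp only [id, HamNP.encode_eq, fstF_boolPair, bitsToNat_encodeNat]
  rw [HamNP.encode_eq] at hle
  rw [min_eq_left hle]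

/-! ### From bit vectors to vertex subsets -/

open scoped Classical in
/-- **The sum over characteristic vectors is the sum over vertex subsets**: for the verifier semantics of
`h2a` and the product weight, `Σ_{z ∈ {0,1}^n} [z independent] ∏_j (z_j ? p : q) = Σ_{I} [I independent]
p^{|I|} q^{n-|I|}`. [folklore] -/
theorem sum_bits_eq_sum_finsets (p q : ℕ) {n : ℕ} (G : SimpleGraph (Fin n)) (P : List Bool → Prop)
    [DecidablePred P]
    (hP : ∀ z : List Bool, P z ↔
      z.length = n ∧ ∀ i j : Fin n, z.getD i false = true → z.getD j false = true → ¬ G.Adj i j) :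
    ∑ z : List.Vector Bool n,
        (if P z.toList then ∏ j ∈ range z.toList.length, (if z.toList.getD j false then p else q) else 0) =
      ∑ I : Finset (Fin n), (if G.IsIndepSet (↑I : Set (Fin n)) then p ^ I.card * q ^ (n - I.card) else 0) := by
  -- pass to bit functions
  rw [← Fintype.sum_equiv (Equiv.vectorEquivFin Bool n).symm _
    (fun z : List.Vector Bool n =>
      if P z.toList then ∏ j ∈ range z.toList.length, (if z.toList.getD j false then p else q) else 0)
    (fun _ => rfl)]
  -- pass to finsets (characteristic functions)
  set e : (Fin n → Bool) ≃ Finset (Fin n) :=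
    { toFun := fun g => univ.filter fun i => g i = true
      invFun := fun I i => decide (i ∈ I)
      left_inv := fun g => by funext i; simp
      right_inv := fun I => by ext i; simp } with he
  rw [← Fintype.sum_equiv e.symm _ _ (fun _ => rfl)]
  refine sum_congr rfl fun I _ => ?_
  -- the bit list of `I`
  have htl : ((Equiv.vectorEquivFin Bool n).symm (e.symm I)).toList =
      List.ofFn fun i : Fin n => decide (i ∈ I) := by
    simp [Equiv.vectorEquivFin, he]
  rw [htl]
  have hget : ∀ i : Fin n, (List.ofFn fun i : Fin n => decide (i ∈ I)).getD i false = decide (i ∈ I) :=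
    fun i => CliqueNP.getD_ofFn _ i
  -- the condition
  have hcond : P (List.ofFn fun i : Fin n => decide (i ∈ I)) ↔ G.IsIndepSet (↑I : Set (Fin n)) := by
    rw [hP, SimpleGraph.IsIndepSet, Set.Pairwise]
    simp only [List.length_ofFn, true_and, hget, decide_eq_true_eq, Finset.mem_coe]
    constructor
    · intro h i hi j hj _
      exact h i j hi hj
    · intro h i j hi hj hadj
      exact h hi hj (G.ne_of_adj hadj) hadj
  -- the weight
  have hwt : ∏ j ∈ range (List.ofFn fun i : Fin n => decide (i ∈ I)).length,
      (if (List.ofFn fun i : Fin n => decide (i ∈ I)).getD j false then p else q) = p ^ I.card * q ^ (n - I.card) := by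
    rw [List.length_ofFn, ← Fin.prod_univ_eq_prod_range
      (fun j => if (List.ofFn fun i : Fin n => decide (i ∈ I)).getD j false then p else q) n]
    simp only [hget, decide_eq_true_eq]
    rw [prod_ite, prod_const, prod_const]
    have hf1 : (univ.filter fun j : Fin n => j ∈ I) = I := by ext i; simp
    have hf2 : (univ.filter fun j : Fin n => ¬ j ∈ I) = Iᶜ := by ext i; simp
    rw [hf1, hf2, card_compl, Fintype.card_fin]
  by_cases hI : G.IsIndepSet (↑I : Set (Fin n))
  · rw [if_pos (hcond.2 hI), if_pos hI, hwt]
  · rw [if_neg (fun h => hI (hcond.1 h)), if_neg hI]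

/-! ### The assembly -/

open scoped Classical in
/-- **Stub T4′ (lead) — `HardcoreCountSharpP` from T1, T2a, T2b given as hypotheses.** The hard-core counting
function `N_{Δ,p,q}` (the route's inlined `match` on `encodingGraph.decode`, = `hardcoreCount Δ p q`) is in
`#P`: `N = Φ ∘ cg` with `Φ = [x ∈ gcodeLang ∩ D] · Σ_{z ∈ {0,1}^{n(x)}} [⟨x,z⟩ ∈ V] · ∏_j (z_j ? p : q)`.
[cite: Valiant1979, §2] -/
theorem stub_sharpPAssembly
    (h1 : ∃ cg ∈ FP, ∀ w : List Bool,
      cg w = (match encodingGraph.decode w with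
        | none => boolPair (encodeNat 1) []
        | some G => encodingGraph.encode G))
    (h2a : ∃ V ∈ Classes.P, ∀ (n : ℕ) (G : SimpleGraph (Fin n)) (z : List Bool),
      boolPair (encodingGraph.encode ⟨n, G⟩) z ∈ V ↔
        z.length = n ∧ ∀ i j : Fin n, z.getD i false = true → z.getD j false = true → ¬ G.Adj i j)
    (h2b : ∀ Δ : ℕ, ∃ D ∈ Classes.P, ∀ (n : ℕ) (G : SimpleGraph (Fin n)),
      encodingGraph.encode ⟨n, G⟩ ∈ D ↔ G.maxDegree ≤ Δ) :
    HardcoreCountSharpP := by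
  intro Δ p q
  change hardcoreCount Δ p q ∈ SharpP
  obtain ⟨cg, hcg, hcg_eq⟩ := h1
  obtain ⟨V, hV, hV_iff⟩ := h2a
  obtain ⟨D, hD, hD_iff⟩ := h2b Δ
  -- the `#P` function `Φ`
  have hφ : (fun v : List Bool => if v ∈ V then
      ∏ j ∈ range (sndF v).length, (if (sndF v).getD j false then p else q) else 0) ∈ SharpP :=
    ParityClosure.ite_mem_SharpP (weightProd_mem_SharpP p q) hV
  have hg : (binToUnaryFn ∘ fanoutFn id fstF) ∈ FP :=
    comp_mem_FP binToUnaryFn_mem_FP (fanoutFn_mem_FP id_mem_FP fstF_mem_FP)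
  have hS := ParityClosure.sum_mem_SharpP hφ hg
  have hΦ := ParityClosure.ite_mem_SharpP hS (inter_mem_P HamNP.gcodeLang_mem_P hD)
  have hcomp := comp_mem_SharpP hΦ hcg
  -- `hardcoreCount = Φ ∘ cg`
  refine (congrArg (· ∈ SharpP) ?_).mp hcomp
  funext w
  simp only [Function.comp_apply, sndF_boolPair]
  rcases hdec : encodingGraph.decode w with _ | ⟨n, G⟩
  · -- undecodable: both sides vanish
    have hw : hardcoreCount Δ p q w = 0 := by simp only [hardcoreCount, hdec]
    have hcgw : cg w = boolPair (encodeNat 1) [] := by rw [hcg_eq w, hdec]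
    rw [hw, hcgw, if_neg (fun h => junk_not_mem_gcodeLang h.1)]
  · have hcgw : cg w = encodingGraph.encode ⟨n, G⟩ := by rw [hcg_eq w, hdec]
    have hcode : encodingGraph.encode ⟨n, G⟩ ∈ HamNP.gcodeLang := (HamNP.mem_gcodeLang_iff _).2 ⟨n, G, rfl⟩
    rw [hcgw]
    by_cases hdeg : G.maxDegree ≤ Δ
    · have hw : hardcoreCount Δ p q w =
          ∑ I : Finset (Fin n), (if G.IsIndepSet (↑I : Set (Fin n)) then p ^ I.card * q ^ (n - I.card) else 0) := by
        simp only [hardcoreCount, hdec, if_pos hdeg]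
      rw [hw, if_pos ⟨hcode, (hD_iff n G).2 hdeg⟩]
      -- transport the index type `List.Vector Bool (g x).length` to `List.Vector Bool n`
      have key : ∀ m : ℕ, m = n →
          ∑ z : List.Vector Bool m, (if boolPair (encodingGraph.encode ⟨n, G⟩) z.toList ∈ V then
              ∏ j ∈ range z.toList.length, (if z.toList.getD j false then p else q) else 0) =
            ∑ I : Finset (Fin n), (if G.IsIndepSet (↑I : Set (Fin n)) then p ^ I.card * q ^ (n - I.card) else 0) := by
        rintro m rfl
        exact sum_bits_eq_sum_finsets p q G (fun z => boolPair (encodingGraph.encode ⟨m, G⟩) z ∈ V) (hV_iff m G)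
      exact key ((binToUnaryFn ∘ fanoutFn id fstF) (encodingGraph.encode ⟨n, G⟩)).length
        (by rw [yard_encode]; simp [ones])
    · have hw : hardcoreCount Δ p q w = 0 := by simp only [hardcoreCount, hdec, if_neg hdeg]
      rw [hw, if_neg (fun h => hdeg ((hD_iff n G).1 h.2))]

end Summit.PneNP.PneNP.Theorems.NoFBPPApproxAboveUniqueness
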